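import Summits.RiemannHypothesis.RiemannHypothesis.Theses.DeBrangesShift
import Summits.RiemannHypothesis.RiemannHypothesis.Theorems.DeBrangesShift.Negative.KernelTestOneCertificate

/-!
# Refutation of `DeBrangesShift.KernelTestOne`: de Branges' kernel test fails at scale `c = 1`

Route `DeBrangesShift` (negative-side route on de Branges' shift family `E_c(z) = ξ(½ + c − 2icz)`)
files as support item `KernelTestOne` (stmt-RiemannHypothesis-1524) the calibration instance `c = 1`
of the Conrey–Li kernel test: `∀ ρ, ξ(ρ) = 0 → 0 ≤ Re{conj ξ′(ρ) · ξ(ρ + 2)}`.  It is **false**: at the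
fourth zero `ρ₄ = ½ + iγ₄`, `γ₄ = 30.42487612585951…`, one has `Re{conj ξ′(ρ₄) · ξ(ρ₄ + 2)} < 0`
(normalised cosine `≈ −0.221`).  The proof (`Theorems/DeBrangesShift/Negative/KernelTestOneCertificate.lean`)
is a kernel-checked interval certificate in the style of
`Literature/Barriers/RiemannHypothesis/DeBrangesPositivityHE.lean` (Conrey–Li's `c = ½` failure at zero 34),
whose evaluator, zero bracket and slope bound are reused verbatim: the `Γ`-free reduction
`Re{conj ξ′(ρ) ξ(ρ+2)} = c · Re{conj ζ′(ρ) · ζ(5/2 + iγ) · ((36γ² − 15) + (8γ³ − 46γ) i)}`, `c > 0`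
(`Γ_ℝ(s+2) = Γ_ℝ(s)·s/(2π)`), the twisted sign test bracketing `γ₄ ∈ [t₁, t₁ + 2⁻³²]`,
`t₁ = 8563841298918132 / 2⁴⁸`, the slope box for `ζ′`, one box evaluation of `ζ(5/2 + iγ)`, and
`decide +kernel` (`Cert.check_holds`; axioms `propext`, `Classical.choice`, `Quot.sound` only).

Outcome for the route: the `c = 1` member of de Branges' family `𝓗(E_c)` fails axiom (3.1) through the
kernel test (with `KernelNecessity`), extending the catalogued barrier `DeBrangesPositivity` (`c = ½`,
Conrey–Li 2000) to the scale `c = 1`, as the route's thesis predicts ("failures expected among the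
first zeros": zeros 4, 6, 7, 9, 12 fail in floating point; zero 4 is certified here).

References: J. B. Conrey, X.-J. Li, *A note on some positivity conditions related to zeta and
L-functions*, IMRN 2000:18, 929–940 (arXiv:math/9812166), §3; H. M. Edwards, *Riemann's Zeta
Function* (1974), §6.4.
-/

open Complex Literature.NumberTheory.LFunctions
open scoped ComplexConjugate

set_option linter.dupNamespace false  -- the mandated namespace repeats `RiemannHypothesis`

namespace Summit.RiemannHypothesis.RiemannHypothesis.Theorems

/-- Refutes `DeBrangesShift.KernelTestOne` [refuted-substantive]: the `c = 1` calibration instance of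
de Branges' kernel test, `∀ ρ, ξ(ρ) = 0 → 0 ≤ Re{conj ξ′(ρ)·ξ(ρ+2)}`, is false; witness: the fourth zero
`ρ₄ = ½ + iγ₄`, `γ₄ ∈ [t₁, t₁ + 2⁻³²]`, `t₁ = 8563841298918132/2⁴⁸ = 30.42487612574…`, where
`Re{conj ξ′(ρ₄)·ξ(ρ₄+2)} < 0` by the kernel-checked interval certificate
`DeBrangesShiftKernelTestOne.Cert.check_holds` / `Cert.exists_zero_kernelTest_neg` of
`Theorems/DeBrangesShift/Negative/KernelTestOneCertificate.lean` (twisted sign test for the zero bracket, slope box for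
`ζ′`, box evaluation of `ζ(5/2+iγ)`, and the `Γ`-free reduction `Γ_ℝ(s+2) = Γ_ℝ(s)s/(2π)`).
No repair is wanted: the route `DeBrangesShift` is a negative-side route and this negation is the
theorem it asks for at scale `c = 1` (de Branges' axiom (3.1) fails for `𝓗(E_1)` via `KernelNecessity`);
barrier-candidate: `DeBrangesPositivity` scope extended from `c = ½` to `c = 1`. [folklore] -/
theorem DeBrangesShiftKernelTestOne_refuted :
    ¬ Summit.RiemannHypothesis.RiemannHypothesis.Theses.DeBrangesShift.KernelTestOne := fun hK ↦ by
  obtain ⟨ρ, hρ0, hneg⟩ := DeBrangesShiftKernelTestOne.Cert.exists_zero_kernelTest_neg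
  exact absurd (hK ρ hρ0) (not_le.mpr hneg)

end Summit.RiemannHypothesis.RiemannHypothesis.Theorems
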